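import Literature.MathematicalPhysics.QuantumLattice.HeisenbergClusterProductUpperBound
import Literature.MathematicalPhysics.QuantumLattice.LiebMattisSectorPF
import HarnessLib

/-!
# The dimer (valence-bond) upper bound for the spin-½ Heisenberg chain: `e ≤ -3J/8`

Topic `MathematicalPhysics/QuantumLattice`; a fully kernel-checked INSTANCE of the cluster-product
upper bound `heisenbergRing_groundEnergy_le_of_clusterTrialEnergy_le` /
`heisenbergEnergyDensity_le_clusterProduct` (`HeisenbergClusterProductUpperBound.lean`) with the
smallest cluster: the open segment of two sites in its singlet state `(|↑↓⟩ - |↓↑⟩)/√2`. The product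
of singlets on the dimers `{2j, 2j+1}` of the ring `ℤ/Lℤ` (`L` even, `L ≥ 4`) has energy `-3J/4` per
dimer and zero mean-field boundary terms, so

* `heisenbergRing_groundEnergy_le_dimer` — `E₀(H_L) ≤ -(3J/8)·L` for `J ≥ 0`, `2 ∣ L`, `L ≥ 4`
  (`H_L = J Σ_i 𝐒_i·𝐒_{i+1}`, spin ½);
* `heisenbergEnergyDensity_one_le_dimer` — in the thermodynamic limit `e(½, d = 1, J) ≤ -3J/8`,
  the classical valence-bond (dimer) variational bound; with the tree's Anderson lower bound
  `heisenbergEnergyDensity_spinHalf_ge_anderson` (`-1/2 ≤ e` at `J = 1`, [cite: Anderson1951]) the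
  chain energy density is bracketed `-1/2 ≤ e ≤ -3/8` with no numerical input
  (`heisenbergEnergyDensity_one_mem_Icc`; Bethe–Hulthén: `1/4 - ln 2 = -0.4431…`).

The singlet's bond energy is obtained without matrix arithmetic: the singlet `u` lies in the
`S^z_tot = 0` sector and is annihilated by `Ŝ⁺_tot` (a two-line computation in the configuration basis),
hence `(𝐒_tot)² u = 0` (`LiebMattis.totalSpinSq_mulVec_of_raise_eq_zero`), and on two sites
`(𝐒_tot)² = 2(S(S+1) + 𝐒_0·𝐒_1)` (`sum_siteSpin_add_mul_self`), so `⟨u, 𝐒_0·𝐒_1 u⟩ = -¾‖u‖²`; the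
boundary term `⟨Sᶻ_1⟩⟨Sᶻ_0⟩ = -⟨Sᶻ_0⟩² ≤ 0` because `⟨Sᶻ_0⟩ + ⟨Sᶻ_1⟩ = ⟨Sᶻ_tot⟩ = 0`.
The dimer states are those of A. Auerbach, *Interacting Electrons and Quantum Magnetism* (Springer, 1994),
§8.2, eq. (8.12) (there as the Majumdar–Ghosh ground states; the Casimir bookkeeping is that of eq. (8.16));
the bound itself is textbook folklore. Lower half of the bracket: P. W. Anderson, Phys. Rev. 83 (1951) 1260
[cite: Anderson1951]. No named facts.
-/

noncomputable section

open Matrix Complex Finset Filter Topology Literature.Probability.LatticeModels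
open scoped ComplexOrder BigOperators

namespace Literature.MathematicalPhysics.QuantumLattice

namespace HeisenbergDimer

open HeisenbergTL LiebMattis

/-! ### The two sites and the four configurations of the dimer -/

/-- The left site `0` of the two-site segment `ℤ/2ℤ`. [folklore] -/
def s0 : TorusSite 1 2 := fun _ => 0

/-- The right site `1` of the two-site segment `ℤ/2ℤ`. [folklore] -/
def s1 : TorusSite 1 2 := fun _ => 1

/-- `0 ≠ 1` in `ℤ/2ℤ`. [folklore] -/
theorem s0_ne_s1 : s0 ≠ s1 := by
  intro h
  have h1 := congrFun h 0
  simp [s0, s1] at h1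

/-- Every site of `ℤ/2ℤ` (one coordinate) is `0` or `1`. [folklore] -/
theorem eq_s0_or_eq_s1 (x : TorusSite 1 2) : x = s0 ∨ x = s1 := by
  rcases Fin.exists_fin_two.mp ⟨(x 0 : ZMod 2), rfl⟩ with h | h
  · left
    funext i
    rw [Fin.fin_one_eq_zero i, s0]
    exact h
  · right
    funext i
    rw [Fin.fin_one_eq_zero i, s1]
    exact h

/-- Sums over the two sites. [folklore] -/
theorem sum_sites {β : Type*} [AddCommMonoid β] (f : TorusSite 1 2 → β) : ∑ x, f x = f s0 + f s1 := by
  refine Fintype.sum_eq_add s0 s1 s0_ne_s1 fun c hc => ?_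
  rcases eq_s0_or_eq_s1 c with h | h
  · exact absurd h hc.1
  · exact absurd h hc.2

/-- `1 = 0 + e₀` in `ℤ/2ℤ`. [folklore] -/
theorem s0_add_single : s0 + Pi.single (0 : Fin 1) (1 : ZMod 2) = s1 := by
  funext i
  rw [Fin.fin_one_eq_zero i, Pi.add_apply, Pi.single_eq_same, s0, s1, zero_add]

/-- `0 = 1 + e₀` in `ℤ/2ℤ` (the partner of the right site is the left site of the next dimer). [folklore] -/
theorem s1_add_single : s1 + Pi.single (0 : Fin 1) (1 : ZMod 2) = s0 := by
  funext i
  rw [Fin.fin_one_eq_zero i, Pi.add_apply, Pi.single_eq_same, s0, s1]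
  decide

/-- A configuration of the dimer is determined by its two values. [folklore] -/
theorem cfg_eq_iff (σ τ : TensorIndex (TorusSite 1 2) 2) : σ = τ ↔ σ s0 = τ s0 ∧ σ s1 = τ s1 := by
  constructor
  · rintro rfl
    exact ⟨rfl, rfl⟩
  · rintro ⟨h0, h1⟩
    funext x
    rcases eq_s0_or_eq_s1 x with h | h
    · rw [h, h0]
    · rw [h, h1]

/-- The configuration `|↑↓⟩` (`σ_0 = 0`, `σ_1 = 1`; `k = 0` is spin up). [folklore] -/
def cfgUD : TensorIndex (TorusSite 1 2) 2 := fun x => if x = s0 then 0 else 1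

/-- The configuration `|↓↑⟩`. [folklore] -/
def cfgDU : TensorIndex (TorusSite 1 2) 2 := fun x => if x = s0 then 1 else 0

/-- Values of `|↑↓⟩`. [folklore] -/
theorem cfgUD_apply : cfgUD s0 = 0 ∧ cfgUD s1 = 1 := by
  refine ⟨if_pos rfl, ?_⟩
  show (if s1 = s0 then (0 : Fin 2) else 1) = 1
  rw [if_neg (Ne.symm s0_ne_s1)]

/-- Values of `|↓↑⟩`. [folklore] -/
theorem cfgDU_apply : cfgDU s0 = 1 ∧ cfgDU s1 = 0 := by
  refine ⟨if_pos rfl, ?_⟩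
  show (if s1 = s0 then (1 : Fin 2) else 0) = 0
  rw [if_neg (Ne.symm s0_ne_s1)]

/-! ### The singlet -/

/-- The (unnormalised) singlet `u = |↑↓⟩ - |↓↑⟩` of the dimer (Auerbach (1994) eq. (8.12)). [folklore] -/
def singletVec : TensorIndex (TorusSite 1 2) 2 → ℂ := fun σ =>
  if σ s0 = 0 ∧ σ s1 = 1 then 1 else if σ s0 = 1 ∧ σ s1 = 0 then -1 else 0

/-- The singlet is supported on the weight-one configurations (`S^z_tot = 0`). [folklore] -/
theorem weight_eq_one_of_singletVec_ne_zero {σ : TensorIndex (TorusSite 1 2) 2} (h : singletVec σ ≠ 0) :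
    (∑ x, (σ x : ℕ)) = 1 := by
  rw [sum_sites]
  unfold singletVec at h
  split_ifs at h with h1 h2
  · rw [h1.1, h1.2]; rfl
  · rw [h2.1, h2.2]; rfl
  · exact absurd rfl h

/-- The singlet vanishes off `|↑↓⟩, |↓↑⟩`. [folklore] -/
theorem singletVec_eq_zero_of_ne {σ : TensorIndex (TorusSite 1 2) 2} (h1 : σ ≠ cfgUD) (h2 : σ ≠ cfgDU) :
    singletVec σ = 0 := by
  unfold singletVec
  rw [Ne, cfg_eq_iff, cfgUD_apply.1, cfgUD_apply.2] at h1
  rw [Ne, cfg_eq_iff, cfgDU_apply.1, cfgDU_apply.2] at h2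
  rw [if_neg h1, if_neg h2]

/-- `‖u‖² = 2`. [folklore] -/
theorem star_singletVec_dotProduct : star singletVec ⬝ᵥ singletVec = 2 := by
  have hne : cfgUD ≠ cfgDU := by
    intro h
    have := congrFun h s0
    rw [cfgUD_apply.1, cfgDU_apply.1] at this
    exact Fin.zero_ne_one this
  rw [dotProduct, Fintype.sum_eq_add cfgUD cfgDU hne]
  · have hUD : singletVec cfgUD = 1 := by
      unfold singletVec; rw [if_pos cfgUD_apply]
    have hDU : singletVec cfgDU = -1 := by
      unfold singletVec
      rw [if_neg, if_pos cfgDU_apply]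
      rw [cfgDU_apply.1]
      exact fun h => Fin.zero_ne_one h.1.symm
    simp only [Pi.star_apply, hUD, hDU]
    norm_num
  · intro σ hσ
    rw [Pi.star_apply, singletVec_eq_zero_of_ne hσ.1 hσ.2, mul_zero]

/-- The magnetisation of the singlet's sector is `|Λ| n/2 - W = 2/2 - 1 = 0`. [folklore] -/
theorem sectorValue_eq_zero : ((Fintype.card (TorusSite 1 2) * 1 : ℕ) : ℝ) / 2 - (1 : ℕ) = 0 := by
  rw [card_torusSite]
  norm_num

/-- The singlet lies in the sector `S^z_tot = 0`. [folklore] -/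
theorem singletVec_mem_spinZSector :
    singletVec ∈ spinZSector (Λ := TorusSite 1 2) 1
      (((Fintype.card (TorusSite 1 2) * 1 : ℕ) : ℝ) / 2 - (1 : ℕ)) := by
  rw [mem_spinZSector_weight_iff]
  intro σ hσ
  by_contra h
  exact hσ (weight_eq_one_of_singletVec_ne_zero h)

/-- **The singlet is a highest-weight vector**: `Ŝ⁺_tot u = 0` (`Ŝ⁺|↓↑⟩ = |↑↑⟩ = Ŝ⁺|↑↓⟩`, and they
cancel). [folklore] -/
theorem raise_mulVec_singletVec :
    (totalSpin 1 0 + I • totalSpin 1 1 : Op (TorusSite 1 2) 2) *ᵥ singletVec = 0 := by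
  funext σ
  rw [raise_mulVec_apply, sum_sites, sum_spinRaise_apply_mul, sum_spinRaise_apply_mul, Pi.zero_apply]
  have hupd0 : ∀ l : Fin 2, Function.update σ s0 l s1 = σ s1 := fun l => Function.update_of_ne (Ne.symm s0_ne_s1) l σ
  have hupd1 : ∀ l : Fin 2, Function.update σ s1 l s0 = σ s0 := fun l => Function.update_of_ne s0_ne_s1 l σ
  have h01 : ∀ l : Fin 2, l = 0 ∨ l = 1 := by decide
  rcases h01 (σ s0) with h0 | h0 <;> rcases h01 (σ s1) with h1 | h1 <;>
    simp [singletVec, h0, h1, hupd0, hupd1, Function.update_self]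

/-- `(𝐒_tot)² u = 0`: a highest-weight vector of the sector `M = 0` has total spin `0`. [folklore] -/
theorem totalSpinSq_mulVec_singletVec : totalSpinSq 1 *ᵥ singletVec = 0 := by
  rw [totalSpinSq_mulVec_of_raise_eq_zero 1 singletVec_mem_spinZSector raise_mulVec_singletVec,
    sectorValue_eq_zero]
  simp

/-- On two sites `Sᵅ_tot = Sᵅ_0 + Sᵅ_1`. [folklore] -/
theorem totalSpin_eq (α : Fin 3) : (totalSpin 1 α : Op (TorusSite 1 2) 2) = siteSpin 1 s0 α + siteSpin 1 s1 α := by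
  unfold totalSpin
  exact sum_sites _

/-- On two sites `(𝐒_tot)² = 2(S(S+1)·1 + 𝐒_0·𝐒_1)` (cf. Auerbach (1994) eq. (8.16)). [folklore] -/
theorem totalSpinSq_eq :
    (totalSpinSq 1 : Op (TorusSite 1 2) 2) =
      (2 : ℂ) • (((casimirValue 1 : ℝ) : ℂ) • (1 : Op (TorusSite 1 2) 2) + spinDot 1 s0 s1) := by
  unfold totalSpinSq
  simp only [totalSpin_eq]
  exact sum_siteSpin_add_mul_self 1 s0_ne_s1

/-- **The singlet bond energy**: `⟨u, 𝐒_0·𝐒_1 u⟩ = -3/2 = -¾‖u‖²` (`𝐒_0·𝐒_1 = ((𝐒_tot)² - 3/2)/2`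
has eigenvalue `-3/4` on spin `0`). [folklore] -/
theorem star_singletVec_dotProduct_spinDot :
    star singletVec ⬝ᵥ (spinDot 1 s0 s1 *ᵥ singletVec) = -(3 / 2 : ℂ) := by
  have h := congrArg (fun v => star singletVec ⬝ᵥ v) totalSpinSq_mulVec_singletVec
  simp only [dotProduct_zero] at h
  rw [totalSpinSq_eq, smul_mulVec, add_mulVec, smul_mulVec, one_mulVec, dotProduct_smul,
    dotProduct_add, dotProduct_smul, star_singletVec_dotProduct, casimirValue] at h
  push_cast at h
  simp only [smul_eq_mul] at h
  linear_combination h / 2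

/-! ### The normalised singlet as a block state -/

/-- The normalised singlet `φ = u/√2`. [folklore] -/
def singletState : TensorIndex (TorusSite 1 2) 2 → ℂ := ((Real.sqrt 2)⁻¹ : ℂ) • singletVec

/-- `‖φ‖ = 1`. [folklore] -/
theorem star_singletState_dotProduct : star singletState ⬝ᵥ singletState = 1 := by
  rw [singletState, star_smul, smul_dotProduct, dotProduct_smul, smul_smul, star_singletVec_dotProduct,
    smul_eq_mul]
  have h2 : (Real.sqrt 2 : ℂ) ^ 2 = 2 := by
    rw [← Complex.ofReal_pow, Real.sq_sqrt (by norm_num : (0 : ℝ) ≤ 2)]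
    norm_num
  have hs : (Real.sqrt 2 : ℂ) ≠ 0 := by
    exact_mod_cast (Real.sqrt_pos.2 (by norm_num : (0 : ℝ) < 2)).ne'
  rw [Complex.star_def, ← Complex.ofReal_inv, Complex.conj_ofReal, Complex.ofReal_inv]
  field_simp
  rw [h2]

/-- `φ` is supported on the weight-one configurations. [folklore] -/
theorem singletState_sector (σ : TensorIndex (TorusSite 1 2) 2) (h : singletState σ ≠ 0) :
    (∑ x, (σ x : ℕ)) = 1 := by
  refine weight_eq_one_of_singletVec_ne_zero fun h0 => h ?_
  rw [singletState, Pi.smul_apply, h0, smul_zero]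

/-- `φ` lies in the sector `S^z_tot = 0`. [folklore] -/
theorem singletState_mem_spinZSector :
    singletState ∈ spinZSector (Λ := TorusSite 1 2) 1
      (((Fintype.card (TorusSite 1 2) * 1 : ℕ) : ℝ) / 2 - (1 : ℕ)) :=
  Submodule.smul_mem _ _ singletVec_mem_spinZSector

/-- Bond energy of the normalised singlet: `Re⟨φ, 𝐒_0·𝐒_1 φ⟩ = -3/4`. [folklore] -/
theorem re_expect_spinDot_singletState :
    (star singletState ⬝ᵥ (spinDot 1 s0 s1 *ᵥ singletState)).re = -(3 / 4 : ℝ) := by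
  rw [singletState, star_smul, mulVec_smul, smul_dotProduct, dotProduct_smul, smul_smul,
    star_singletVec_dotProduct_spinDot, smul_eq_mul, Complex.star_def, ← Complex.ofReal_inv,
    Complex.conj_ofReal]
  have h2 : ((Real.sqrt 2)⁻¹ : ℝ) * (Real.sqrt 2)⁻¹ = 1 / 2 := by
    rw [← mul_inv, Real.mul_self_sqrt (by norm_num : (0 : ℝ) ≤ 2)]
    norm_num
  rw [← Complex.ofReal_mul, h2]
  norm_num

/-- The two `Sᶻ` expectations of `φ` cancel: `Re⟨φ, Sᶻ_0 φ⟩ + Re⟨φ, Sᶻ_1 φ⟩ = 0` (`S^z_tot φ = 0`).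
[folklore] -/
theorem re_expect_spinZ_add :
    (star singletState ⬝ᵥ (siteSpin 1 s0 2 *ᵥ singletState)).re +
      (star singletState ⬝ᵥ (siteSpin 1 s1 2 *ᵥ singletState)).re = 0 := by
  have h := totalSpin_two_mulVec_of_mem 1 singletState_mem_spinZSector
  rw [sectorValue_eq_zero, Complex.ofReal_zero, zero_smul, totalSpin_eq, add_mulVec] at h
  have h2 := congrArg (fun v => (star singletState ⬝ᵥ v).re) h
  simp only [dotProduct_add, Complex.add_re, dotProduct_zero, Complex.zero_re] at h2
  exact h2

/-- **The trial energy per dimer is at most `-3/4`**: the bond inside the dimer gives `-3/4`, the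
mean-field term of the bond to the next dimer is `⟨Sᶻ_1⟩⟨Sᶻ_0⟩ = -⟨Sᶻ_0⟩² ≤ 0`. [folklore] -/
theorem clusterTrialEnergy_singletState_le :
    clusterTrialEnergy 1 (fun _ : Fin 1 => 2) singletState ≤ -(3 / 4 : ℝ) := by
  unfold clusterTrialEnergy
  rw [sum_sites, Fin.sum_univ_one, Fin.sum_univ_one,
    clusterBondTerm_eq_of_sector 1 (fun _ : Fin 1 => 2) singletState singletState_sector,
    clusterBondTerm_eq_of_sector 1 (fun _ : Fin 1 => 2) singletState singletState_sector]
  have h0 : ((s0 (0 : Fin 1)).val + 1 < (fun _ : Fin 1 => 2) 0) := by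
    show (0 : ZMod 2).val + 1 < 2
    decide
  have h1 : ¬ ((s1 (0 : Fin 1)).val + 1 < (fun _ : Fin 1 => 2) 0) := by
    show ¬ ((1 : ZMod 2).val + 1 < 2)
    decide
  rw [if_pos h0, if_neg h1, s0_add_single, s1_add_single, re_expect_spinDot_singletState]
  set a := (star singletState ⬝ᵥ (siteSpin 1 s0 2 *ᵥ singletState)).re with ha
  set b := (star singletState ⬝ᵥ (siteSpin 1 s1 2 *ᵥ singletState)).re with hb
  have hba : b * a = -(a ^ 2) := by
    have hz := re_expect_spinZ_add
    rw [← ha, ← hb] at hz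
    have : b = -a := by linarith
    rw [this]
    ring
  rw [hba]
  nlinarith [sq_nonneg a]

end HeisenbergDimer

open HeisenbergDimer HeisenbergTL

/-- **The dimer bound for the Heisenberg ring**: for spin `½`, `J ≥ 0` and every even `L ≥ 4`,
`E₀(J Σ_i 𝐒_i·𝐒_{i+1} on ℤ/Lℤ) ≤ -(3J/8)·L` — the product of singlets on the dimers `{2j, 2j+1}` is a
trial state with energy `-3J/4` per dimer (its inter-dimer bonds contribute `0`). An instance of
`heisenbergRing_groundEnergy_le_of_clusterTrialEnergy_le` with no numerical input; the trial state is the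
dimer state of Auerbach (1994) §8.2, eq. (8.12). [folklore] -/
theorem heisenbergRing_groundEnergy_le_dimer {J : ℝ} (hJ : 0 ≤ J) (L : ℕ) [NeZero L] (hdvd : 2 ∣ L)
    (hL : 4 ≤ L) :
    (heisenbergHamiltonian 1 (torusGraph 1 L) J).groundEnergy ≤ -(3 * J / 8) * L := by
  have hq : J * clusterTrialEnergy 1 (fun _ : Fin 1 => 2) singletState ≤ -(3 * J / 8) * (2 : ℕ) := by
    have h := mul_le_mul_of_nonneg_left clusterTrialEnergy_singletState_le hJ
    push_cast
    linarith
  exact heisenbergRing_groundEnergy_le_of_clusterTrialEnergy_le 1 J (a := 2) le_rfl singletState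
    star_singletState_dotProduct hq L hdvd (by omega)

/-- **The dimer (valence-bond) upper bound for the Heisenberg chain in the thermodynamic limit**: for
spin `½` and `J ≥ 0`, `e(1, 1, J) = lim_L E₀(H_L)/L ≤ -3J/8` (dimer product state;
`heisenbergEnergyDensity_le_clusterProduct` with the two-site cluster). Together with
`heisenbergEnergyDensity_spinHalf_ge_anderson` (`-1/2 ≤ e` at `J = 1`, [cite: Anderson1951]) this brackets
the chain: `-1/2 ≤ e ≤ -3/8` (Bethe–Hulthén: `1/4 - ln 2 = -0.4431…`). [folklore] -/
theorem heisenbergEnergyDensity_one_le_dimer {J : ℝ} (hJ : 0 ≤ J) :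
    heisenbergEnergyDensity 1 1 J ≤ -(3 * J / 8) := by
  have h := heisenbergEnergyDensity_le_clusterProduct 1 le_rfl hJ (fun _ : Fin 1 => 2) singletState
    star_singletState_dotProduct
  rw [Fin.prod_univ_one] at h
  have h2 := mul_le_mul_of_nonneg_left clusterTrialEnergy_singletState_le hJ
  have h3 : J * clusterTrialEnergy 1 (fun _ : Fin 1 => 2) singletState / ((2 : ℕ) : ℝ) ≤ -(3 * J / 8) := by
    push_cast
    rw [div_le_iff₀ (by norm_num : (0 : ℝ) < 2)]
    linarith
  exact h.trans h3

/-- The bracket at `J = 1`: `-1/2 ≤ e ≤ -3/8` for the spin-½ Heisenberg antiferromagnetic chain, both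
halves kernel-checked (lower: Anderson's bound [cite: Anderson1951]; upper: the dimer product state).
[folklore] -/
theorem heisenbergEnergyDensity_one_mem_Icc :
    heisenbergEnergyDensity 1 1 1 ∈ Set.Icc (-(1 / 2 : ℝ)) (-(3 / 8 : ℝ)) := by
  refine ⟨?_, ?_⟩
  · have h := heisenbergEnergyDensity_spinHalf_ge_anderson (d := 1) le_rfl
    norm_num at h ⊢
    exact h
  · have h := heisenbergEnergyDensity_one_le_dimer (J := 1) zero_le_one
    norm_num at h ⊢
    exact h

end Literature.MathematicalPhysics.QuantumLattice

end
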